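/-
Copyright (c) 2026 the pub-hodgecm-mathlib formalisation cell (harness21).  Prover seat hodgecm-mathlib-F0P3a-p01 (g38), explicit-unit SUPPORTS-ONLY on h413, req620 Track A
«(D-RAM) FOUR-FRAME» squad ((β₂) road (R-36) «PURE-CELL LEDGER», lane A (Unr-K): ED. 2′ — the ℓ₀-SHIFTED ROW CUT `2b + d % 2`, lane-A twin of LH4-p04 (g9)'s ★ p863108 `beta2ConesB_of_rows₂`;
forced by F0P3-p01 (g37)'s d = 3 Unr-K census 2026-09-05T01:44Z (live row at `2b + 1 = m` at odd d) — type block swapped, proof byte-identical), 2026-09-05.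
-/
import Summits.HodgeConjecture.HodgeConjecture.Theorems.F0P3cDyRamCleanSgnDiffTypeTwoCellsBNear      -- ★ p862116 (this lineage): brings every token of the cells currency (★ p861305 §3, ★ DEFS)
import Summits.HodgeConjecture.HodgeConjecture.Theorems.F0P3cDyRamAxisColumnZeroOfFrame             -- ★ p862391: `formCongr_one_antidiagonal_three_eq_endoShape_two`; brings ★ `det_antidiagonal_two`
import HarnessLib

/-!
# LANE-A (Unr-K) TWIN: `beta2ConesA_of_rows₂ (N) (hoff : ‹OFF-A.letter.v2›) (hrow : ‹ROW-A.letter.v2›) : ‹beta2ConesA.letter.v2 493c2faf VERBATIM›` — ‹OFF-A.v2›∕‹ROW-A.v2› = the lane-B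
# ‹OFF.v2›∕‹ROW.v2› texts with the type block swapped (`_hτ : |ρα − Θα| < 1`; `_hres ∕ _hΘne ∕ _hDM` out; `_hddE _hfixE _h2M` in); SUPERSEDES (as consumer) ★ p863139 `beta2ConesA_of_rows`
# (cut `2 * b ≠ m`, the d-even cut: at ODD d the Unr-K live row is `2b + 1 = m` — F0P3-p01 (g37) key (16,9): ANISO head (6,8) PURE −1536 = HYP (7,8) PURE −1536).
# In lane A there is NO parity law `m ≡ d (2)`; the cut is still right because at `m ≢ d (2)` every Unr-K cell is balanced (E2B (4); c10 (10,8)).  Text below = lane B verbatim otherwise.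
# Crux `H413`, line LH4 «(D-RAM) FOUR-FRAME» — (β₂) road, β₂-BOARD v2 row (L-Σ), brick (L-Σ-3B) ED. 2′ (WORD #18 PARITY RULING): «THE CONE LEDGER IS THE LIVE ROW» —
# `beta2ConesB_of_rows₂ (N) (hoff : ‹OFF.letter.v2›) (hrow : ‹ROW.letter.v2›) : ‹beta2ConesB.letter.v2 (cda107a9) VERBATIM›`

Cell `hodgecm-mathlib` (D-0151), FLOOR 0, crux item H413 = `stmt-HodgeConjecture-24833`, route of record `HCCMUnconditional`; squad F0∕P3c∕LH4; lane
`--supports stmt-HodgeConjecture-24833 --as helper` (count-neutral; pays NO tier-0 row).  THEOREMS ONLY (no `def`∕instance∕notation∕`sorry`; default heartbeats).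
GENERIC ∕ DATUM-FREE (no CM token).  THE PARITY POINT (β₂ WORD #18).  By ★ `normOneSq_depth_parity` (at `a := lam · jE(u₀₀)⁻¹`, with `tE < m`) the depth `m`
of a cone row has the parity of `d`: at EVEN `d` the live (labelled, unbalanced) row of the RamK cone ledger is `2b = m` (ED. 2, ★ p862801), at ODD `d` (R-P places) it is
`2b + 1 = m`.  ED. 2's letter ‹OFF.letter.v1› cut at `2 * b ≠ m` is therefore the d-even cut only; THIS FILE re-cuts at the parity-uniform token `2 * b + d % 2`:
* **‹OFF.letter.v2›** (binder `hoff`; text `F0/P3c/LH4/LH4-p04/g9/OFF.letter.v2.LH4p04g9.lean.txt`) = ‹OFF.letter.v1› with the one token `2 * b ≠ m ↦ 2 * b + d % 2 ≠ m`: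
  ONE-LITERAL, GENERAL-BLOCK (`H₂, h_W, P₁, γ, φ, h, f, R` in ★ p861305 §3's spelling): `∀ b ∈ Icc 1 R, 2b + d % 2 ≠ m → ∀ j < J+1, IsOrd_j lam → cellDiff(j,b) = 0`;
* **‹ROW.letter.v2›** (binder `hrow`; text `…/ROW.letter.v2.LH4p04g9.lean.txt`) = ‹ROW.letter.v1› with the filter `fun b => 2 * b + d % 2 = m` on each `Icc 1 R_t`:
  `Σ_{b ∈ Icc 1 R, 2b + d%2 = m} Σ_j […]·cellDiff_H(j,b) = Σ_{b ∈ Icc 1 R′, 2b + d%2 = m} Σ_j […]·cellDiff_A(j,b)` — supplied by `row₂_of_even_odd` (sibling file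
  `F0P3cDyRamRowParitySplit`) from the EVEN row (‹ROW.letter.v1› ⟸ ★ `row_of_core` ⟸ ‹WR› + ‹CORE›) and the ODD-d row (‹ROW-ODD.letter.v1›, open).
PROOF.  ★ p862801's, at the parity predicate: `Finset.sum_filter_add_sum_filter_not` at `p b :≡ 2·b + d % 2 = m` on each literal's `Icc 1 R_t`; the `¬p` parts vanish
summand-wise by ‹OFF.v2› instantiated at `((Φ₂).over E, 1, 1, γ₂)` (★ `det_antidiagonal_two`, ★ `StdForm.over_map`∕`transpose_over`, ★ `formCongr_one_antidiagonal_three_eq_endoShape_two`)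
and at `(diag dg, η, P₁, γ₁)` (`tr ∕ det γ₁` from `charpoly γ₁ = charpoly γ₂`); the `p` parts agree by ‹ROW.v2›.
HONEST LABEL.  A reduction; nothing printed is asserted; ‹OFF.v2› and ‹ROW.v2› are OPEN hypotheses (β₂ UNPROVED — witness-true on the engine rows); `HC_CM` is proved only
modulo the 7 printed citations (2 remaining named inputs: hLiu418 = `stmt-HodgeConjecture-24832`, h413 = `stmt-HodgeConjecture-24833`) until rung 0 closes.
References: [Kottwitz1986BaseChangeUnits] §1 pp. 240–241 (cell-by-cell lattice counts) · [Rogawski1990] §4.9 Prop. 4.9.1 (b) p. 55, Lemma 4.9.3 p. 56 · [Jacobowitz1962] §4.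
-/

set_option autoImplicit false

noncomputable section
namespace Summit.HodgeConjecture.HodgeConjecture.Cruxes.H413.F0P3cDyRamBeta2ConesAOfRowsParity

open scoped Matrix MatrixGroups Classical Valued WithZero
open Literature.NumberTheory.Automorphic Literature.NumberTheory.Automorphic.UnitaryThreeFourFrame Literature.NumberTheory.Automorphic.UnitaryLatticeTree
open Literature.NumberTheory.Automorphic.HermitianLattice Literature.NumberTheory.Automorphic.EllipticPlaneAsFieldLine Literature.NumberTheory.LocalFields.QuadraticOrder
open Literature.NumberTheory.Rogawski1990
open Summit.HodgeConjecture.HodgeConjecture.Cruxes.H413.F0P3cDyRamToricCensusDefs Summit.HodgeConjecture.HodgeConjecture.Cruxes.H413.F0P3cDyRamFourFramePieces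
open Summit.HodgeConjecture.HodgeConjecture.Cruxes.H413.F0P3cDyRamFourFrameCensusDefs Summit.HodgeConjecture.HodgeConjecture.Cruxes.H413.F0P3cDyRamStageOneBDefs
open Summit.HodgeConjecture.HodgeConjecture.Cruxes.H413.F0P3cDyRamAxisColumnZeroOfFrame Summit.HodgeConjecture.HodgeConjecture.Cruxes.H413

/-- **(L-Σ-3A) ED. 2′ — THE GENERIC CONE LEDGER OF THE Unr-K LANE FROM ‹OFF-A.v2› AND ‹ROW-A.v2› (ℓ₀-shifted live row `2b + d % 2 = m`; lane-A twin of ★ p863108 `beta2ConesB_of_rows₂`, type block swapped, no parity law used)** (`N` = the depth fence parameter, passed through): see the module docstring.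
[cite: Kottwitz1986BaseChangeUnits, §1 pp. 240–241] [cite: Rogawski1990, §4.9 Prop. 4.9.1 (b) p. 55, Lemma 4.9.3 p. 56] [cite: Jacobowitz1962, §4] -/
theorem beta2ConesA_of_rows₂ (N : ℕ → ℕ → ℕ → ℕ)
    (hoff :
      ∀ (E M : Type) [Field E] [Valued E ℤᵐ⁰] [CompleteSpace E] [IsDiscreteValuationRing 𝒪[E]] [Finite 𝓀[E]]
        [Field M] [Valued M ℤᵐ⁰] [CompleteSpace M] [IsDiscreteValuationRing 𝒪[M]] [Finite 𝓀[M]]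
        (σ : E →+* E) (ϖ : E) (d tE : ℕ) (_hD : IsRamifiedQuadraticDatum σ ϖ d tE) (_hσσ : ∀ a, σ (σ a) = a) (_h2 : ¬ IsUnit (2 : 𝒪[E]))
        (jE : E →+* M) (ρ Θ : M →+* M) (α lam : M)
        (_hρρ : ∀ z, ρ (ρ z) = z) (_hvρ : ∀ z, Valued.v (ρ z) = Valued.v z) (_hρj : ∀ a, ρ (jE a) = jE a)
        (_hjv : ∀ a, Valued.v (jE a) ≤ 1 ↔ Valued.v a ≤ 1) (_hjfix : ∀ z : M, ρ z = z ↔ ∃ a, jE a = z) (_hΘj : ∀ a, Θ (jE a) = jE (σ a))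
        (_hΘΘ : ∀ z, Θ (Θ z) = z) (_hΘρ : ∀ z, Θ (ρ z) = ρ (Θ z)) (_hvΘ : ∀ z, Valued.v (Θ z) = Valued.v z)
        (_hα : ρ α ≠ α) (_hα1 : Valued.v α ≤ 1) (_hint : ∀ z : M, Valued.v z ≤ 1 → Valued.v ((z - ρ z) / (α - ρ α)) ≤ 1)
        (_hΘlam : Θ lam * lam = 1) (_hvlam : Valued.v lam = 1) (_hbasis : ∀ z : M, ∃! pq : E × E, z = jE pq.1 + jE pq.2 * lam)
        (_hU : Valued.v (α - ρ α) = 1) (_hτ : Valued.v (ρ α - Θ α) < 1)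
        (_hσres : ∀ z : M, ρ z = z → Valued.v z ≤ 1 → Valued.v (Θ z - z) < 1)
        (_hjiso : ∀ a, Valued.v (jE a) = Valued.v a)
        (_hq : Nat.card 𝓀[M] = Nat.card 𝓀[E] ^ 2) (_hddE : Valued.v (jE ϖ - Θ (jE ϖ)) = Valued.v (jE ϖ) ^ d)
        (_hfixE : ∀ z : M, ρ z = z → Θ z = z → z ≠ 0 → ∃ n : ℤ, Valued.v z = WithZero.exp (2 * n)) (_h2M : Valued.v (2 : M) = Valued.v (jE ϖ) ^ tE) (_hjpow : ∀ (t : E) (n : ℤ), Valued.v (jE t) = Valued.v (jE ϖ) ^ n ↔ Valued.v t = Valued.v ϖ ^ n)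
        (_hEval : ∀ c : M, ρ c = c → c ≠ 0 → Valued.v c ≤ 1 → ∃ n : ℕ, Valued.v c = Valued.v (jE ϖ) ^ n)
        (_hϖmax : ∀ t : M, ρ t = t → Valued.v t < 1 → Valued.v t ≤ Valued.v (jE ϖ))
        (γ₂ : GL (Fin 2) E) (u : GL (Fin 1) E)
        (_hdet : (γ₂ : Matrix (Fin 2) (Fin 2) E).det * σ (γ₂ : Matrix (Fin 2) (Fin 2) E).det = 1)
        (_htr : (γ₂ : Matrix (Fin 2) (Fin 2) E).trace = (γ₂ : Matrix (Fin 2) (Fin 2) E).det * σ (γ₂ : Matrix (Fin 2) (Fin 2) E).trace)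
        (_hirr : ∀ x : E, x * x - (γ₂ : Matrix (Fin 2) (Fin 2) E).trace * x + (γ₂ : Matrix (Fin 2) (Fin 2) E).det ≠ 0)
        (_hlam2 : lam * lam = jE (γ₂ : Matrix (Fin 2) (Fin 2) E).trace * lam - jE (γ₂ : Matrix (Fin 2) (Fin 2) E).det)
        (_hρlam : ρ lam = jE (γ₂ : Matrix (Fin 2) (Fin 2) E).trace - lam) (m jl : ℕ) (_hm : Valued.v (lam - jE ((u : Matrix (Fin 1) (Fin 1) E) 0 0)) = WithZero.exp (-(m : ℤ)))
        (_hjl : Valued.v ((lam - jE ((u : Matrix (Fin 1) (Fin 1) E) 0 0)) - ρ (lam - jE ((u : Matrix (Fin 1) (Fin 1) E) 0 0))) = WithZero.exp (-(jl : ℤ)))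
        (_hs : Valued.v ((γ₂ : Matrix (Fin 2) (Fin 2) E).trace - 2) * Valued.v (ϖ ^ (d % 2)) ≤ Valued.v (ϖ ^ mcOfRecord d))
        (_hp : Valued.v ((γ₂ : Matrix (Fin 2) (Fin 2) E).det - (γ₂ : Matrix (Fin 2) (Fin 2) E).trace + 1) ≤ Valued.v (ϖ ^ mcOfRecord d))
        (_hNm : N d tE (Nat.card 𝓀[E]) ≤ m) (_hu1N : Valued.v (((u : Matrix (Fin 1) (Fin 1) E) 0 0) - 1) ≤ Valued.v (ϖ ^ N d tE (Nat.card 𝓀[E]))) (_hlam1 : Valued.v (lam - 1) ≤ Valued.v (jE ϖ ^ N d tE (Nat.card 𝓀[E])))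
        (_hu : Valued.v ((u : Matrix (Fin 1) (Fin 1) E) 0 0) = 1) (_hum : Valued.v (((u : Matrix (Fin 1) (Fin 1) E) 0 0) - 1) ≤ Valued.v (ϖ ^ mstarOfRecord d))
        (H₂ : Matrix (Fin 2) (Fin 2) E) (hW : E) (_hH₂ : IsUnit H₂.det) (_hH₂σ : (H₂.map σ)ᵀ = H₂) (_hhW : Valued.v hW = 1) (_hhWσ : σ hW = hW)
        (P₁ : GL (Fin 3) E) (_hA : formCongr σ P₁ ((StdForm.antidiagonal 3).over E) = (!![H₂ 0 0, 0, H₂ 0 1; 0, hW, 0; H₂ 1 0, 0, H₂ 1 1] : Matrix (Fin 3) (Fin 3) E))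
        (_hΓ : P₁ * endoGL (γ₂, u) * P₁⁻¹ ∈ unitaryGroupOfForm σ ((StdForm.antidiagonal 3).over E))
        (φ : (Fin 2 → E) →+ M) (h : M) (_hφs : ∀ (c : E) (x : Fin 2 → E), φ (c • x) = jE c * φ x) (_hφi : Function.Injective φ) (_hφo : Function.Surjective φ)
        (_hφγ : ∀ x, φ ((γ₂ : Matrix (Fin 2) (Fin 2) E).mulVec x) = lam * φ x)
        (_hform : ∀ x y, jE (pairing σ H₂ x y) = h * Θ (φ x) * φ y + ρ (h * Θ (φ x) * φ y)) (_hΘh : Θ h = h) (_hh : h ≠ 0)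
        (J R : ℕ) (f : ℕ → ℕ → AddSubgroup M → ℕ)
        (_hfinF : {L₃ : Submodule 𝒪[E] (Fin 3 → E) | IsSelfDualLattice σ ϖ (!![H₂ 0 0, 0, H₂ 0 1; 0, hW, 0; H₂ 1 0, 0, H₂ 1 1] : Matrix (Fin 3) (Fin 3) E) L₃ ∧ mapGL (endoGL (γ₂, u)) L₃ = L₃}.Finite)
        (_hR : ∀ L₃ : Submodule 𝒪[E] (Fin 3 → E), IsSelfDualLattice σ ϖ (!![H₂ 0 0, 0, H₂ 0 1; 0, hW, 0; H₂ 1 0, 0, H₂ 1 1] : Matrix (Fin 3) (Fin 3) E) L₃ →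
          mapGL (endoGL (γ₂, u)) L₃ = L₃ → ∀ b : ℕ, (∀ c : E, (Pi.single 1 c : Fin 3 → E) ∈ L₃ ↔ Valued.v c ≤ Valued.v ϖ ^ b) → b ≤ R)
        (_hJ : ¬ IsOrd ρ α (jE ϖ ^ (J + 1)) lam) (_hfinLS : ∀ j a, (levelSet ρ Θ α (jE ϖ) h j a).Finite)
        (_hf : ∀ (b j : ℕ) (Λ : AddSubgroup M) (x₀ : M) (r : E), 1 ≤ b → x₀ ≠ 0 → (∀ x, x ∈ Λ ↔ ∃ z, IsOrd ρ α (jE ϖ ^ j) z ∧ x = x₀ * z) →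
          IsOrd ρ α (jE ϖ ^ j) (dualGen ρ Θ α (jE ϖ ^ j) h x₀) → ¬ IsOrd ρ α (jE ϖ ^ j) (dualGen ρ Θ α (jE ϖ ^ j) h x₀ / jE ϖ) → Valued.v (dualGen ρ Θ α (jE ϖ ^ j) h x₀) = Valued.v (jE ϖ) ^ b →
          (∀ b', (∀ x ∈ Λ, Valued.v (h * Θ x * b' + ρ (h * Θ x * b')) ≤ 1) → (lam - jE ((u : Matrix (Fin 1) (Fin 1) E) 0 0)) * b' ∈ Λ) → IsOrd ρ α (jE ϖ ^ j) lam →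
          jE r = glueUnit ρ Θ α (jE ϖ ^ j) h (jE ϖ) (jE hW) x₀ b →
          f b j Λ = Nat.card {x : 𝒪[E] ⧸ 𝓂[E] ^ (2 * b) // ∃ u' : 𝒪[E], Ideal.Quotient.mk (𝓂[E] ^ (2 * b)) u' = x ∧ Valued.v ((u' : E) * σ u' - r) ≤ Valued.v (ϖ ^ (2 * b))}),
        ∀ b ∈ Finset.Icc 1 R, 2 * b + d % 2 ≠ m → ∀ j ∈ Finset.range (J + 1), IsOrd ρ α (jE ϖ ^ j) lam →
                ((∑ᶠ Λ ∈ levelSetDep ρ Θ α (jE ϖ) h j b (lam - jE ((u : Matrix (Fin 1) (Fin 1) E) 0 0)) ∩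
                      {Λ | ∃ B : Submodule 𝒪[E] (Fin 2 → E), B.toAddSubgroup.map φ = Λ ∧
                        ∃ L₃ : Submodule 𝒪[E] (Fin 3 → E), IsSelfDualLattice σ ϖ (!![H₂ 0 0, 0, H₂ 0 1; 0, hW, 0; H₂ 1 0, 0, H₂ 1 1] : Matrix (Fin 3) (Fin 3) E) L₃ ∧
                          L₃ ⊓ LinearMap.ker ((LinearMap.proj (1 : Fin 3) : (Fin 3 → E) →ₗ[E] E).restrictScalars 𝒪[E]) =
                            B.map ((Matrix.toLin' (!![1, 0; 0, 0; 0, 1] : Matrix (Fin 3) (Fin 2) E)).restrictScalars 𝒪[E]) ∧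
                          (∀ c : E, (Pi.single 1 c : Fin 3 → E) ∈ L₃ ↔ Valued.v c ≤ Valued.v ϖ ^ b) ∧
                          (LatticeNearTransvShell ϖ (d % 2) (mstarOfRecord d) ((((endoGL (γ₂, u) : GL (Fin 3) E) : Matrix (Fin 3) (Fin 3) E) - 1)) L₃ ∧
                            {z : E | ∃ y ∈ L₃, Valued.v ((ϖ ^ (mstarOfRecord d))⁻¹ * (z - pairing σ (!![H₂ 0 0, 0, H₂ 0 1; 0, hW, 0; H₂ 1 0, 0, H₂ 1 1] : Matrix (Fin 3) (Fin 3) E) y (((((endoGL (γ₂, u) : GL (Fin 3) E) : Matrix (Fin 3) (Fin 3) E) - 1)) *ᵥ y))) ≤ 1} =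
                              valueSetMod σ ϖ (mstarOfRecord d) (xPlus σ ϖ d))}, f b j Λ : ℕ) : ℤ) -
                  ((∑ᶠ Λ ∈ levelSetDep ρ Θ α (jE ϖ) h j b (lam - jE ((u : Matrix (Fin 1) (Fin 1) E) 0 0)) ∩
                      {Λ | ∃ B : Submodule 𝒪[E] (Fin 2 → E), B.toAddSubgroup.map φ = Λ ∧
                        ∃ L₃ : Submodule 𝒪[E] (Fin 3 → E), IsSelfDualLattice σ ϖ (!![H₂ 0 0, 0, H₂ 0 1; 0, hW, 0; H₂ 1 0, 0, H₂ 1 1] : Matrix (Fin 3) (Fin 3) E) L₃ ∧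
                          L₃ ⊓ LinearMap.ker ((LinearMap.proj (1 : Fin 3) : (Fin 3 → E) →ₗ[E] E).restrictScalars 𝒪[E]) =
                            B.map ((Matrix.toLin' (!![1, 0; 0, 0; 0, 1] : Matrix (Fin 3) (Fin 2) E)).restrictScalars 𝒪[E]) ∧
                          (∀ c : E, (Pi.single 1 c : Fin 3 → E) ∈ L₃ ↔ Valued.v c ≤ Valued.v ϖ ^ b) ∧
                          (LatticeNearTransvShell ϖ (d % 2) (mcOfRecord d) ((((endoGL (γ₂, u) : GL (Fin 3) E) : Matrix (Fin 3) (Fin 3) E) - 1)) L₃ ∧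
                            ¬ {z : E | ∃ y ∈ L₃, Valued.v ((ϖ ^ (mstarOfRecord d))⁻¹ * (z - pairing σ (!![H₂ 0 0, 0, H₂ 0 1; 0, hW, 0; H₂ 1 0, 0, H₂ 1 1] : Matrix (Fin 3) (Fin 3) E) y (((((endoGL (γ₂, u) : GL (Fin 3) E) : Matrix (Fin 3) (Fin 3) E) - 1)) *ᵥ y))) ≤ 1} =
                              valueSetMod σ ϖ (mstarOfRecord d) (xPlus σ ϖ d))}, f b j Λ : ℕ) : ℤ) = 0)
    (hrow :
      ∀ (E M : Type) [Field E] [Valued E ℤᵐ⁰] [CompleteSpace E] [IsDiscreteValuationRing 𝒪[E]] [Finite 𝓀[E]]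
        [Field M] [Valued M ℤᵐ⁰] [CompleteSpace M] [IsDiscreteValuationRing 𝒪[M]] [Finite 𝓀[M]]
        (σ : E →+* E) (ϖ : E) (d tE : ℕ) (_hD : IsRamifiedQuadraticDatum σ ϖ d tE) (_hσσ : ∀ a, σ (σ a) = a) (_h2 : ¬ IsUnit (2 : 𝒪[E]))
        (jE : E →+* M) (ρ Θ : M →+* M) (α lam : M)
        (_hρρ : ∀ z, ρ (ρ z) = z) (_hvρ : ∀ z, Valued.v (ρ z) = Valued.v z) (_hρj : ∀ a, ρ (jE a) = jE a)
        (_hjv : ∀ a, Valued.v (jE a) ≤ 1 ↔ Valued.v a ≤ 1) (_hjfix : ∀ z : M, ρ z = z ↔ ∃ a, jE a = z) (_hΘj : ∀ a, Θ (jE a) = jE (σ a))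
        (_hΘΘ : ∀ z, Θ (Θ z) = z) (_hΘρ : ∀ z, Θ (ρ z) = ρ (Θ z)) (_hvΘ : ∀ z, Valued.v (Θ z) = Valued.v z)
        (_hα : ρ α ≠ α) (_hα1 : Valued.v α ≤ 1) (_hint : ∀ z : M, Valued.v z ≤ 1 → Valued.v ((z - ρ z) / (α - ρ α)) ≤ 1)
        (_hΘlam : Θ lam * lam = 1) (_hvlam : Valued.v lam = 1) (_hbasis : ∀ z : M, ∃! pq : E × E, z = jE pq.1 + jE pq.2 * lam)
        (_hU : Valued.v (α - ρ α) = 1) (_hτ : Valued.v (ρ α - Θ α) < 1)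
        (_hσres : ∀ z : M, ρ z = z → Valued.v z ≤ 1 → Valued.v (Θ z - z) < 1)
        (_hjiso : ∀ a, Valued.v (jE a) = Valued.v a)
        (_hq : Nat.card 𝓀[M] = Nat.card 𝓀[E] ^ 2) (_hddE : Valued.v (jE ϖ - Θ (jE ϖ)) = Valued.v (jE ϖ) ^ d)
        (_hfixE : ∀ z : M, ρ z = z → Θ z = z → z ≠ 0 → ∃ n : ℤ, Valued.v z = WithZero.exp (2 * n)) (_h2M : Valued.v (2 : M) = Valued.v (jE ϖ) ^ tE) (_hjpow : ∀ (t : E) (n : ℤ), Valued.v (jE t) = Valued.v (jE ϖ) ^ n ↔ Valued.v t = Valued.v ϖ ^ n)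
        (_hEval : ∀ c : M, ρ c = c → c ≠ 0 → Valued.v c ≤ 1 → ∃ n : ℕ, Valued.v c = Valued.v (jE ϖ) ^ n)
        (_hϖmax : ∀ t : M, ρ t = t → Valued.v t < 1 → Valued.v t ≤ Valued.v (jE ϖ))
        (γ₂ : GL (Fin 2) E) (u : GL (Fin 1) E)
        (_hdet : (γ₂ : Matrix (Fin 2) (Fin 2) E).det * σ (γ₂ : Matrix (Fin 2) (Fin 2) E).det = 1)
        (_htr : (γ₂ : Matrix (Fin 2) (Fin 2) E).trace = (γ₂ : Matrix (Fin 2) (Fin 2) E).det * σ (γ₂ : Matrix (Fin 2) (Fin 2) E).trace)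
        (_hirr : ∀ x : E, x * x - (γ₂ : Matrix (Fin 2) (Fin 2) E).trace * x + (γ₂ : Matrix (Fin 2) (Fin 2) E).det ≠ 0)
        (_hlam2 : lam * lam = jE (γ₂ : Matrix (Fin 2) (Fin 2) E).trace * lam - jE (γ₂ : Matrix (Fin 2) (Fin 2) E).det)
        (_hρlam : ρ lam = jE (γ₂ : Matrix (Fin 2) (Fin 2) E).trace - lam) (m jl : ℕ) (_hm : Valued.v (lam - jE ((u : Matrix (Fin 1) (Fin 1) E) 0 0)) = WithZero.exp (-(m : ℤ)))
        (_hjl : Valued.v ((lam - jE ((u : Matrix (Fin 1) (Fin 1) E) 0 0)) - ρ (lam - jE ((u : Matrix (Fin 1) (Fin 1) E) 0 0))) = WithZero.exp (-(jl : ℤ)))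
        (_hs : Valued.v ((γ₂ : Matrix (Fin 2) (Fin 2) E).trace - 2) * Valued.v (ϖ ^ (d % 2)) ≤ Valued.v (ϖ ^ mcOfRecord d))
        (_hp : Valued.v ((γ₂ : Matrix (Fin 2) (Fin 2) E).det - (γ₂ : Matrix (Fin 2) (Fin 2) E).trace + 1) ≤ Valued.v (ϖ ^ mcOfRecord d))
        (_hNm : N d tE (Nat.card 𝓀[E]) ≤ m) (_hu1N : Valued.v (((u : Matrix (Fin 1) (Fin 1) E) 0 0) - 1) ≤ Valued.v (ϖ ^ N d tE (Nat.card 𝓀[E]))) (_hlam1 : Valued.v (lam - 1) ≤ Valued.v (jE ϖ ^ N d tE (Nat.card 𝓀[E])))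
        (_hu : Valued.v ((u : Matrix (Fin 1) (Fin 1) E) 0 0) = 1) (_hum : Valued.v (((u : Matrix (Fin 1) (Fin 1) E) 0 0) - 1) ≤ Valued.v (ϖ ^ mstarOfRecord d))
        (_hg1 : ∀ i j, Valued.v ((γ₂ : Matrix (Fin 2) (Fin 2) E) i j - (1 : Matrix (Fin 2) (Fin 2) E) i j) ≤ Valued.v (ϖ ^ N d tE (Nat.card 𝓀[E]))) (P₁ : GL (Fin 3) E) (dg : Fin 2 → E) (η : E) (γ₁ : GL (Fin 2) E)
        (_hΓ : endoGL (γ₂, u) ∈ unitaryGroupOfForm σ ((StdForm.antidiagonal 3).over E))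
        (_hΓ' : P₁ * endoGL (γ₁, u) * P₁⁻¹ ∈ unitaryGroupOfForm σ ((StdForm.antidiagonal 3).over E))
        (_hA : formCongr σ P₁ ((StdForm.antidiagonal 3).over E) = (!![(Matrix.diagonal dg) 0 0, 0, (Matrix.diagonal dg) 0 1; 0, η, 0; (Matrix.diagonal dg) 1 0, 0, (Matrix.diagonal dg) 1 1] : Matrix (Fin 3) (Fin 3) E))
        (_hdg1 : ∀ i, Valued.v (dg i) = 1) (_hdgσ : ∀ i, σ (dg i) = dg i) (_hησ : σ η = η) (_hη1 : Valued.v η = 1) (_hηN : ¬ ∃ t : E, t * σ t = η)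
        (_hγ₁ : γ₁ ∈ unitaryGroupOfForm σ (Matrix.diagonal dg)) (_hA12 : (γ₁ : Matrix (Fin 2) (Fin 2) E).charpoly = (γ₂ : Matrix (Fin 2) (Fin 2) E).charpoly)
        (φ : (Fin 2 → E) →+ M) (h : M) (φ' : (Fin 2 → E) →+ M) (h' : M) (_hφs : ∀ (c : E) (x : Fin 2 → E), φ (c • x) = jE c * φ x) (_hφi : Function.Injective φ) (_hφo : Function.Surjective φ)
        (_hφγ : ∀ x, φ ((γ₂ : Matrix (Fin 2) (Fin 2) E).mulVec x) = lam * φ x)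
        (_hform : ∀ x y, jE (pairing σ ((StdForm.antidiagonal 2).over E) x y) = h * Θ (φ x) * φ y + ρ (h * Θ (φ x) * φ y)) (_hΘh : Θ h = h) (_hh : h ≠ 0)
        (_hhyper : ∃ x : M, x ≠ 0 ∧ h * Θ x * x + ρ (h * Θ x * x) = 0)
        (_hφ's : ∀ (c : E) (x : Fin 2 → E), φ' (c • x) = jE c * φ' x) (_hφ'i : Function.Injective φ') (_hφ'o : Function.Surjective φ')
        (_hφ'γ : ∀ x, φ' ((γ₁ : Matrix (Fin 2) (Fin 2) E).mulVec x) = lam * φ' x)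
        (_hform' : ∀ x y, jE (pairing σ (Matrix.diagonal dg) x y) = h' * Θ (φ' x) * φ' y + ρ (h' * Θ (φ' x) * φ' y)) (_hΘh' : Θ h' = h') (_hh' : h' ≠ 0)
        (J R R' : ℕ) (f f' : ℕ → ℕ → AddSubgroup M → ℕ)
        (_hfinF : {L₃ : Submodule 𝒪[E] (Fin 3 → E) | IsSelfDualLattice σ ϖ (!![((StdForm.antidiagonal 2).over E) 0 0, 0, ((StdForm.antidiagonal 2).over E) 0 1; 0, (1 : E), 0; ((StdForm.antidiagonal 2).over E) 1 0, 0, ((StdForm.antidiagonal 2).over E) 1 1] : Matrix (Fin 3) (Fin 3) E) L₃ ∧ mapGL (endoGL (γ₂, u)) L₃ = L₃}.Finite)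
        (_hR : ∀ L₃ : Submodule 𝒪[E] (Fin 3 → E), IsSelfDualLattice σ ϖ (!![((StdForm.antidiagonal 2).over E) 0 0, 0, ((StdForm.antidiagonal 2).over E) 0 1; 0, (1 : E), 0; ((StdForm.antidiagonal 2).over E) 1 0, 0, ((StdForm.antidiagonal 2).over E) 1 1] : Matrix (Fin 3) (Fin 3) E) L₃ →
          mapGL (endoGL (γ₂, u)) L₃ = L₃ → ∀ b : ℕ, (∀ c : E, (Pi.single 1 c : Fin 3 → E) ∈ L₃ ↔ Valued.v c ≤ Valued.v ϖ ^ b) → b ≤ R)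
        (_hfinF' : {L₃ : Submodule 𝒪[E] (Fin 3 → E) | IsSelfDualLattice σ ϖ (!![(Matrix.diagonal dg) 0 0, 0, (Matrix.diagonal dg) 0 1; 0, η, 0; (Matrix.diagonal dg) 1 0, 0, (Matrix.diagonal dg) 1 1] : Matrix (Fin 3) (Fin 3) E) L₃ ∧ mapGL (endoGL (γ₁, u)) L₃ = L₃}.Finite)
        (_hR' : ∀ L₃ : Submodule 𝒪[E] (Fin 3 → E), IsSelfDualLattice σ ϖ (!![(Matrix.diagonal dg) 0 0, 0, (Matrix.diagonal dg) 0 1; 0, η, 0; (Matrix.diagonal dg) 1 0, 0, (Matrix.diagonal dg) 1 1] : Matrix (Fin 3) (Fin 3) E) L₃ →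
          mapGL (endoGL (γ₁, u)) L₃ = L₃ → ∀ b : ℕ, (∀ c : E, (Pi.single 1 c : Fin 3 → E) ∈ L₃ ↔ Valued.v c ≤ Valued.v ϖ ^ b) → b ≤ R')
        (_hJ : ¬ IsOrd ρ α (jE ϖ ^ (J + 1)) lam) (_hfinLS : ∀ j a, (levelSet ρ Θ α (jE ϖ) h j a).Finite) (_hfinLS' : ∀ j a, (levelSet ρ Θ α (jE ϖ) h' j a).Finite)
        (_hf : ∀ (b j : ℕ) (Λ : AddSubgroup M) (x₀ : M) (r : E), 1 ≤ b → x₀ ≠ 0 → (∀ x, x ∈ Λ ↔ ∃ z, IsOrd ρ α (jE ϖ ^ j) z ∧ x = x₀ * z) →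
          IsOrd ρ α (jE ϖ ^ j) (dualGen ρ Θ α (jE ϖ ^ j) h x₀) → ¬ IsOrd ρ α (jE ϖ ^ j) (dualGen ρ Θ α (jE ϖ ^ j) h x₀ / jE ϖ) → Valued.v (dualGen ρ Θ α (jE ϖ ^ j) h x₀) = Valued.v (jE ϖ) ^ b →
          (∀ b', (∀ x ∈ Λ, Valued.v (h * Θ x * b' + ρ (h * Θ x * b')) ≤ 1) → (lam - jE ((u : Matrix (Fin 1) (Fin 1) E) 0 0)) * b' ∈ Λ) → IsOrd ρ α (jE ϖ ^ j) lam →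
          jE r = glueUnit ρ Θ α (jE ϖ ^ j) h (jE ϖ) (jE 1) x₀ b →
          f b j Λ = Nat.card {x : 𝒪[E] ⧸ 𝓂[E] ^ (2 * b) // ∃ u' : 𝒪[E], Ideal.Quotient.mk (𝓂[E] ^ (2 * b)) u' = x ∧ Valued.v ((u' : E) * σ u' - r) ≤ Valued.v (ϖ ^ (2 * b))})
        (_hf' : ∀ (b j : ℕ) (Λ : AddSubgroup M) (x₀ : M) (r : E), 1 ≤ b → x₀ ≠ 0 → (∀ x, x ∈ Λ ↔ ∃ z, IsOrd ρ α (jE ϖ ^ j) z ∧ x = x₀ * z) →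
          IsOrd ρ α (jE ϖ ^ j) (dualGen ρ Θ α (jE ϖ ^ j) h' x₀) → ¬ IsOrd ρ α (jE ϖ ^ j) (dualGen ρ Θ α (jE ϖ ^ j) h' x₀ / jE ϖ) → Valued.v (dualGen ρ Θ α (jE ϖ ^ j) h' x₀) = Valued.v (jE ϖ) ^ b →
          (∀ b', (∀ x ∈ Λ, Valued.v (h' * Θ x * b' + ρ (h' * Θ x * b')) ≤ 1) → (lam - jE ((u : Matrix (Fin 1) (Fin 1) E) 0 0)) * b' ∈ Λ) → IsOrd ρ α (jE ϖ ^ j) lam →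
          jE r = glueUnit ρ Θ α (jE ϖ ^ j) h' (jE ϖ) (jE η) x₀ b →
          f' b j Λ = Nat.card {x : 𝒪[E] ⧸ 𝓂[E] ^ (2 * b) // ∃ u' : 𝒪[E], Ideal.Quotient.mk (𝓂[E] ^ (2 * b)) u' = x ∧ Valued.v ((u' : E) * σ u' - r) ≤ Valued.v (ϖ ^ (2 * b))}),
            ∑ b ∈ (Finset.Icc 1 R).filter (fun b => 2 * b + d % 2 = m), ∑ j ∈ Finset.range (J + 1), (if IsOrd ρ α (jE ϖ ^ j) lam then
                ((∑ᶠ Λ ∈ levelSetDep ρ Θ α (jE ϖ) h j b (lam - jE ((u : Matrix (Fin 1) (Fin 1) E) 0 0)) ∩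
                      {Λ | ∃ B : Submodule 𝒪[E] (Fin 2 → E), B.toAddSubgroup.map φ = Λ ∧
                        ∃ L₃ : Submodule 𝒪[E] (Fin 3 → E), IsSelfDualLattice σ ϖ (!![((StdForm.antidiagonal 2).over E) 0 0, 0, ((StdForm.antidiagonal 2).over E) 0 1; 0, (1 : E), 0; ((StdForm.antidiagonal 2).over E) 1 0, 0, ((StdForm.antidiagonal 2).over E) 1 1] : Matrix (Fin 3) (Fin 3) E) L₃ ∧
                          L₃ ⊓ LinearMap.ker ((LinearMap.proj (1 : Fin 3) : (Fin 3 → E) →ₗ[E] E).restrictScalars 𝒪[E]) =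
                            B.map ((Matrix.toLin' (!![1, 0; 0, 0; 0, 1] : Matrix (Fin 3) (Fin 2) E)).restrictScalars 𝒪[E]) ∧
                          (∀ c : E, (Pi.single 1 c : Fin 3 → E) ∈ L₃ ↔ Valued.v c ≤ Valued.v ϖ ^ b) ∧
                          (LatticeNearTransvShell ϖ (d % 2) (mstarOfRecord d) ((((endoGL (γ₂, u) : GL (Fin 3) E) : Matrix (Fin 3) (Fin 3) E) - 1)) L₃ ∧
                            {z : E | ∃ y ∈ L₃, Valued.v ((ϖ ^ (mstarOfRecord d))⁻¹ * (z - pairing σ (!![((StdForm.antidiagonal 2).over E) 0 0, 0, ((StdForm.antidiagonal 2).over E) 0 1; 0, (1 : E), 0; ((StdForm.antidiagonal 2).over E) 1 0, 0, ((StdForm.antidiagonal 2).over E) 1 1] : Matrix (Fin 3) (Fin 3) E) y (((((endoGL (γ₂, u) : GL (Fin 3) E) : Matrix (Fin 3) (Fin 3) E) - 1)) *ᵥ y))) ≤ 1} =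
                              valueSetMod σ ϖ (mstarOfRecord d) (xPlus σ ϖ d))}, f b j Λ : ℕ) : ℤ) -
                  ((∑ᶠ Λ ∈ levelSetDep ρ Θ α (jE ϖ) h j b (lam - jE ((u : Matrix (Fin 1) (Fin 1) E) 0 0)) ∩
                      {Λ | ∃ B : Submodule 𝒪[E] (Fin 2 → E), B.toAddSubgroup.map φ = Λ ∧
                        ∃ L₃ : Submodule 𝒪[E] (Fin 3 → E), IsSelfDualLattice σ ϖ (!![((StdForm.antidiagonal 2).over E) 0 0, 0, ((StdForm.antidiagonal 2).over E) 0 1; 0, (1 : E), 0; ((StdForm.antidiagonal 2).over E) 1 0, 0, ((StdForm.antidiagonal 2).over E) 1 1] : Matrix (Fin 3) (Fin 3) E) L₃ ∧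
                          L₃ ⊓ LinearMap.ker ((LinearMap.proj (1 : Fin 3) : (Fin 3 → E) →ₗ[E] E).restrictScalars 𝒪[E]) =
                            B.map ((Matrix.toLin' (!![1, 0; 0, 0; 0, 1] : Matrix (Fin 3) (Fin 2) E)).restrictScalars 𝒪[E]) ∧
                          (∀ c : E, (Pi.single 1 c : Fin 3 → E) ∈ L₃ ↔ Valued.v c ≤ Valued.v ϖ ^ b) ∧
                          (LatticeNearTransvShell ϖ (d % 2) (mcOfRecord d) ((((endoGL (γ₂, u) : GL (Fin 3) E) : Matrix (Fin 3) (Fin 3) E) - 1)) L₃ ∧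
                            ¬ {z : E | ∃ y ∈ L₃, Valued.v ((ϖ ^ (mstarOfRecord d))⁻¹ * (z - pairing σ (!![((StdForm.antidiagonal 2).over E) 0 0, 0, ((StdForm.antidiagonal 2).over E) 0 1; 0, (1 : E), 0; ((StdForm.antidiagonal 2).over E) 1 0, 0, ((StdForm.antidiagonal 2).over E) 1 1] : Matrix (Fin 3) (Fin 3) E) y (((((endoGL (γ₂, u) : GL (Fin 3) E) : Matrix (Fin 3) (Fin 3) E) - 1)) *ᵥ y))) ≤ 1} =
                              valueSetMod σ ϖ (mstarOfRecord d) (xPlus σ ϖ d))}, f b j Λ : ℕ) : ℤ) else 0) =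
            ∑ b ∈ (Finset.Icc 1 R').filter (fun b => 2 * b + d % 2 = m), ∑ j ∈ Finset.range (J + 1), (if IsOrd ρ α (jE ϖ ^ j) lam then
                ((∑ᶠ Λ ∈ levelSetDep ρ Θ α (jE ϖ) h' j b (lam - jE ((u : Matrix (Fin 1) (Fin 1) E) 0 0)) ∩
                      {Λ | ∃ B : Submodule 𝒪[E] (Fin 2 → E), B.toAddSubgroup.map φ' = Λ ∧
                        ∃ L₃ : Submodule 𝒪[E] (Fin 3 → E), IsSelfDualLattice σ ϖ (!![(Matrix.diagonal dg) 0 0, 0, (Matrix.diagonal dg) 0 1; 0, η, 0; (Matrix.diagonal dg) 1 0, 0, (Matrix.diagonal dg) 1 1] : Matrix (Fin 3) (Fin 3) E) L₃ ∧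
                          L₃ ⊓ LinearMap.ker ((LinearMap.proj (1 : Fin 3) : (Fin 3 → E) →ₗ[E] E).restrictScalars 𝒪[E]) =
                            B.map ((Matrix.toLin' (!![1, 0; 0, 0; 0, 1] : Matrix (Fin 3) (Fin 2) E)).restrictScalars 𝒪[E]) ∧
                          (∀ c : E, (Pi.single 1 c : Fin 3 → E) ∈ L₃ ↔ Valued.v c ≤ Valued.v ϖ ^ b) ∧
                          (LatticeNearTransvShell ϖ (d % 2) (mstarOfRecord d) ((((endoGL (γ₁, u) : GL (Fin 3) E) : Matrix (Fin 3) (Fin 3) E) - 1)) L₃ ∧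
                            {z : E | ∃ y ∈ L₃, Valued.v ((ϖ ^ (mstarOfRecord d))⁻¹ * (z - pairing σ (!![(Matrix.diagonal dg) 0 0, 0, (Matrix.diagonal dg) 0 1; 0, η, 0; (Matrix.diagonal dg) 1 0, 0, (Matrix.diagonal dg) 1 1] : Matrix (Fin 3) (Fin 3) E) y (((((endoGL (γ₁, u) : GL (Fin 3) E) : Matrix (Fin 3) (Fin 3) E) - 1)) *ᵥ y))) ≤ 1} =
                              valueSetMod σ ϖ (mstarOfRecord d) (xPlus σ ϖ d))}, f' b j Λ : ℕ) : ℤ) -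
                  ((∑ᶠ Λ ∈ levelSetDep ρ Θ α (jE ϖ) h' j b (lam - jE ((u : Matrix (Fin 1) (Fin 1) E) 0 0)) ∩
                      {Λ | ∃ B : Submodule 𝒪[E] (Fin 2 → E), B.toAddSubgroup.map φ' = Λ ∧
                        ∃ L₃ : Submodule 𝒪[E] (Fin 3 → E), IsSelfDualLattice σ ϖ (!![(Matrix.diagonal dg) 0 0, 0, (Matrix.diagonal dg) 0 1; 0, η, 0; (Matrix.diagonal dg) 1 0, 0, (Matrix.diagonal dg) 1 1] : Matrix (Fin 3) (Fin 3) E) L₃ ∧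
                          L₃ ⊓ LinearMap.ker ((LinearMap.proj (1 : Fin 3) : (Fin 3 → E) →ₗ[E] E).restrictScalars 𝒪[E]) =
                            B.map ((Matrix.toLin' (!![1, 0; 0, 0; 0, 1] : Matrix (Fin 3) (Fin 2) E)).restrictScalars 𝒪[E]) ∧
                          (∀ c : E, (Pi.single 1 c : Fin 3 → E) ∈ L₃ ↔ Valued.v c ≤ Valued.v ϖ ^ b) ∧
                          (LatticeNearTransvShell ϖ (d % 2) (mcOfRecord d) ((((endoGL (γ₁, u) : GL (Fin 3) E) : Matrix (Fin 3) (Fin 3) E) - 1)) L₃ ∧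
                            ¬ {z : E | ∃ y ∈ L₃, Valued.v ((ϖ ^ (mstarOfRecord d))⁻¹ * (z - pairing σ (!![(Matrix.diagonal dg) 0 0, 0, (Matrix.diagonal dg) 0 1; 0, η, 0; (Matrix.diagonal dg) 1 0, 0, (Matrix.diagonal dg) 1 1] : Matrix (Fin 3) (Fin 3) E) y (((((endoGL (γ₁, u) : GL (Fin 3) E) : Matrix (Fin 3) (Fin 3) E) - 1)) *ᵥ y))) ≤ 1} =
                              valueSetMod σ ϖ (mstarOfRecord d) (xPlus σ ϖ d))}, f' b j Λ : ℕ) : ℤ) else 0)) :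
      ∀ (E M : Type) [Field E] [Valued E ℤᵐ⁰] [CompleteSpace E] [IsDiscreteValuationRing 𝒪[E]] [Finite 𝓀[E]]
        [Field M] [Valued M ℤᵐ⁰] [CompleteSpace M] [IsDiscreteValuationRing 𝒪[M]] [Finite 𝓀[M]]
        (σ : E →+* E) (ϖ : E) (d tE : ℕ) (_hD : IsRamifiedQuadraticDatum σ ϖ d tE) (_hσσ : ∀ a, σ (σ a) = a) (_h2 : ¬ IsUnit (2 : 𝒪[E]))
        (jE : E →+* M) (ρ Θ : M →+* M) (α lam : M)
        (_hρρ : ∀ z, ρ (ρ z) = z) (_hvρ : ∀ z, Valued.v (ρ z) = Valued.v z) (_hρj : ∀ a, ρ (jE a) = jE a)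
        (_hjv : ∀ a, Valued.v (jE a) ≤ 1 ↔ Valued.v a ≤ 1) (_hjfix : ∀ z : M, ρ z = z ↔ ∃ a, jE a = z) (_hΘj : ∀ a, Θ (jE a) = jE (σ a))
        (_hΘΘ : ∀ z, Θ (Θ z) = z) (_hΘρ : ∀ z, Θ (ρ z) = ρ (Θ z)) (_hvΘ : ∀ z, Valued.v (Θ z) = Valued.v z)
        (_hα : ρ α ≠ α) (_hα1 : Valued.v α ≤ 1) (_hint : ∀ z : M, Valued.v z ≤ 1 → Valued.v ((z - ρ z) / (α - ρ α)) ≤ 1)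
        (_hΘlam : Θ lam * lam = 1) (_hvlam : Valued.v lam = 1) (_hbasis : ∀ z : M, ∃! pq : E × E, z = jE pq.1 + jE pq.2 * lam)
        (_hU : Valued.v (α - ρ α) = 1) (_hτ : Valued.v (ρ α - Θ α) < 1)
        (_hσres : ∀ z : M, ρ z = z → Valued.v z ≤ 1 → Valued.v (Θ z - z) < 1)
        (_hjiso : ∀ a, Valued.v (jE a) = Valued.v a)
        (_hq : Nat.card 𝓀[M] = Nat.card 𝓀[E] ^ 2) (_hddE : Valued.v (jE ϖ - Θ (jE ϖ)) = Valued.v (jE ϖ) ^ d)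
        (_hfixE : ∀ z : M, ρ z = z → Θ z = z → z ≠ 0 → ∃ n : ℤ, Valued.v z = WithZero.exp (2 * n)) (_h2M : Valued.v (2 : M) = Valued.v (jE ϖ) ^ tE) (_hjpow : ∀ (t : E) (n : ℤ), Valued.v (jE t) = Valued.v (jE ϖ) ^ n ↔ Valued.v t = Valued.v ϖ ^ n)
        (_hEval : ∀ c : M, ρ c = c → c ≠ 0 → Valued.v c ≤ 1 → ∃ n : ℕ, Valued.v c = Valued.v (jE ϖ) ^ n)
        (_hϖmax : ∀ t : M, ρ t = t → Valued.v t < 1 → Valued.v t ≤ Valued.v (jE ϖ))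
        (γ₂ : GL (Fin 2) E) (u : GL (Fin 1) E)
        (_hdet : (γ₂ : Matrix (Fin 2) (Fin 2) E).det * σ (γ₂ : Matrix (Fin 2) (Fin 2) E).det = 1)
        (_htr : (γ₂ : Matrix (Fin 2) (Fin 2) E).trace = (γ₂ : Matrix (Fin 2) (Fin 2) E).det * σ (γ₂ : Matrix (Fin 2) (Fin 2) E).trace)
        (_hirr : ∀ x : E, x * x - (γ₂ : Matrix (Fin 2) (Fin 2) E).trace * x + (γ₂ : Matrix (Fin 2) (Fin 2) E).det ≠ 0)
        (_hlam2 : lam * lam = jE (γ₂ : Matrix (Fin 2) (Fin 2) E).trace * lam - jE (γ₂ : Matrix (Fin 2) (Fin 2) E).det)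
        (_hρlam : ρ lam = jE (γ₂ : Matrix (Fin 2) (Fin 2) E).trace - lam) (m jl : ℕ) (_hm : Valued.v (lam - jE ((u : Matrix (Fin 1) (Fin 1) E) 0 0)) = WithZero.exp (-(m : ℤ)))
        (_hjl : Valued.v ((lam - jE ((u : Matrix (Fin 1) (Fin 1) E) 0 0)) - ρ (lam - jE ((u : Matrix (Fin 1) (Fin 1) E) 0 0))) = WithZero.exp (-(jl : ℤ)))
        (_hs : Valued.v ((γ₂ : Matrix (Fin 2) (Fin 2) E).trace - 2) * Valued.v (ϖ ^ (d % 2)) ≤ Valued.v (ϖ ^ mcOfRecord d))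
        (_hp : Valued.v ((γ₂ : Matrix (Fin 2) (Fin 2) E).det - (γ₂ : Matrix (Fin 2) (Fin 2) E).trace + 1) ≤ Valued.v (ϖ ^ mcOfRecord d))
        (_hNm : N d tE (Nat.card 𝓀[E]) ≤ m) (_hu1N : Valued.v (((u : Matrix (Fin 1) (Fin 1) E) 0 0) - 1) ≤ Valued.v (ϖ ^ N d tE (Nat.card 𝓀[E]))) (_hlam1 : Valued.v (lam - 1) ≤ Valued.v (jE ϖ ^ N d tE (Nat.card 𝓀[E])))
        (_hu : Valued.v ((u : Matrix (Fin 1) (Fin 1) E) 0 0) = 1) (_hum : Valued.v (((u : Matrix (Fin 1) (Fin 1) E) 0 0) - 1) ≤ Valued.v (ϖ ^ mstarOfRecord d))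
        (_hg1 : ∀ i j, Valued.v ((γ₂ : Matrix (Fin 2) (Fin 2) E) i j - (1 : Matrix (Fin 2) (Fin 2) E) i j) ≤ Valued.v (ϖ ^ N d tE (Nat.card 𝓀[E]))) (P₁ : GL (Fin 3) E) (dg : Fin 2 → E) (η : E) (γ₁ : GL (Fin 2) E)
        (_hΓ : endoGL (γ₂, u) ∈ unitaryGroupOfForm σ ((StdForm.antidiagonal 3).over E))
        (_hΓ' : P₁ * endoGL (γ₁, u) * P₁⁻¹ ∈ unitaryGroupOfForm σ ((StdForm.antidiagonal 3).over E))
        (_hA : formCongr σ P₁ ((StdForm.antidiagonal 3).over E) = (!![(Matrix.diagonal dg) 0 0, 0, (Matrix.diagonal dg) 0 1; 0, η, 0; (Matrix.diagonal dg) 1 0, 0, (Matrix.diagonal dg) 1 1] : Matrix (Fin 3) (Fin 3) E))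
        (_hdg1 : ∀ i, Valued.v (dg i) = 1) (_hdgσ : ∀ i, σ (dg i) = dg i) (_hησ : σ η = η) (_hη1 : Valued.v η = 1) (_hηN : ¬ ∃ t : E, t * σ t = η)
        (_hγ₁ : γ₁ ∈ unitaryGroupOfForm σ (Matrix.diagonal dg)) (_hA12 : (γ₁ : Matrix (Fin 2) (Fin 2) E).charpoly = (γ₂ : Matrix (Fin 2) (Fin 2) E).charpoly)
        (φ : (Fin 2 → E) →+ M) (h : M) (φ' : (Fin 2 → E) →+ M) (h' : M) (_hφs : ∀ (c : E) (x : Fin 2 → E), φ (c • x) = jE c * φ x) (_hφi : Function.Injective φ) (_hφo : Function.Surjective φ)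
        (_hφγ : ∀ x, φ ((γ₂ : Matrix (Fin 2) (Fin 2) E).mulVec x) = lam * φ x)
        (_hform : ∀ x y, jE (pairing σ ((StdForm.antidiagonal 2).over E) x y) = h * Θ (φ x) * φ y + ρ (h * Θ (φ x) * φ y)) (_hΘh : Θ h = h) (_hh : h ≠ 0)
        (_hhyper : ∃ x : M, x ≠ 0 ∧ h * Θ x * x + ρ (h * Θ x * x) = 0)
        (_hφ's : ∀ (c : E) (x : Fin 2 → E), φ' (c • x) = jE c * φ' x) (_hφ'i : Function.Injective φ') (_hφ'o : Function.Surjective φ')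
        (_hφ'γ : ∀ x, φ' ((γ₁ : Matrix (Fin 2) (Fin 2) E).mulVec x) = lam * φ' x)
        (_hform' : ∀ x y, jE (pairing σ (Matrix.diagonal dg) x y) = h' * Θ (φ' x) * φ' y + ρ (h' * Θ (φ' x) * φ' y)) (_hΘh' : Θ h' = h') (_hh' : h' ≠ 0)
        (J R R' : ℕ) (f f' : ℕ → ℕ → AddSubgroup M → ℕ)
        (_hfinF : {L₃ : Submodule 𝒪[E] (Fin 3 → E) | IsSelfDualLattice σ ϖ (!![((StdForm.antidiagonal 2).over E) 0 0, 0, ((StdForm.antidiagonal 2).over E) 0 1; 0, (1 : E), 0; ((StdForm.antidiagonal 2).over E) 1 0, 0, ((StdForm.antidiagonal 2).over E) 1 1] : Matrix (Fin 3) (Fin 3) E) L₃ ∧ mapGL (endoGL (γ₂, u)) L₃ = L₃}.Finite)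
        (_hR : ∀ L₃ : Submodule 𝒪[E] (Fin 3 → E), IsSelfDualLattice σ ϖ (!![((StdForm.antidiagonal 2).over E) 0 0, 0, ((StdForm.antidiagonal 2).over E) 0 1; 0, (1 : E), 0; ((StdForm.antidiagonal 2).over E) 1 0, 0, ((StdForm.antidiagonal 2).over E) 1 1] : Matrix (Fin 3) (Fin 3) E) L₃ →
          mapGL (endoGL (γ₂, u)) L₃ = L₃ → ∀ b : ℕ, (∀ c : E, (Pi.single 1 c : Fin 3 → E) ∈ L₃ ↔ Valued.v c ≤ Valued.v ϖ ^ b) → b ≤ R)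
        (_hfinF' : {L₃ : Submodule 𝒪[E] (Fin 3 → E) | IsSelfDualLattice σ ϖ (!![(Matrix.diagonal dg) 0 0, 0, (Matrix.diagonal dg) 0 1; 0, η, 0; (Matrix.diagonal dg) 1 0, 0, (Matrix.diagonal dg) 1 1] : Matrix (Fin 3) (Fin 3) E) L₃ ∧ mapGL (endoGL (γ₁, u)) L₃ = L₃}.Finite)
        (_hR' : ∀ L₃ : Submodule 𝒪[E] (Fin 3 → E), IsSelfDualLattice σ ϖ (!![(Matrix.diagonal dg) 0 0, 0, (Matrix.diagonal dg) 0 1; 0, η, 0; (Matrix.diagonal dg) 1 0, 0, (Matrix.diagonal dg) 1 1] : Matrix (Fin 3) (Fin 3) E) L₃ →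
          mapGL (endoGL (γ₁, u)) L₃ = L₃ → ∀ b : ℕ, (∀ c : E, (Pi.single 1 c : Fin 3 → E) ∈ L₃ ↔ Valued.v c ≤ Valued.v ϖ ^ b) → b ≤ R')
        (_hJ : ¬ IsOrd ρ α (jE ϖ ^ (J + 1)) lam) (_hfinLS : ∀ j a, (levelSet ρ Θ α (jE ϖ) h j a).Finite) (_hfinLS' : ∀ j a, (levelSet ρ Θ α (jE ϖ) h' j a).Finite)
        (_hf : ∀ (b j : ℕ) (Λ : AddSubgroup M) (x₀ : M) (r : E), 1 ≤ b → x₀ ≠ 0 → (∀ x, x ∈ Λ ↔ ∃ z, IsOrd ρ α (jE ϖ ^ j) z ∧ x = x₀ * z) →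
          IsOrd ρ α (jE ϖ ^ j) (dualGen ρ Θ α (jE ϖ ^ j) h x₀) → ¬ IsOrd ρ α (jE ϖ ^ j) (dualGen ρ Θ α (jE ϖ ^ j) h x₀ / jE ϖ) → Valued.v (dualGen ρ Θ α (jE ϖ ^ j) h x₀) = Valued.v (jE ϖ) ^ b →
          (∀ b', (∀ x ∈ Λ, Valued.v (h * Θ x * b' + ρ (h * Θ x * b')) ≤ 1) → (lam - jE ((u : Matrix (Fin 1) (Fin 1) E) 0 0)) * b' ∈ Λ) → IsOrd ρ α (jE ϖ ^ j) lam →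
          jE r = glueUnit ρ Θ α (jE ϖ ^ j) h (jE ϖ) (jE 1) x₀ b →
          f b j Λ = Nat.card {x : 𝒪[E] ⧸ 𝓂[E] ^ (2 * b) // ∃ u' : 𝒪[E], Ideal.Quotient.mk (𝓂[E] ^ (2 * b)) u' = x ∧ Valued.v ((u' : E) * σ u' - r) ≤ Valued.v (ϖ ^ (2 * b))})
        (_hf' : ∀ (b j : ℕ) (Λ : AddSubgroup M) (x₀ : M) (r : E), 1 ≤ b → x₀ ≠ 0 → (∀ x, x ∈ Λ ↔ ∃ z, IsOrd ρ α (jE ϖ ^ j) z ∧ x = x₀ * z) →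
          IsOrd ρ α (jE ϖ ^ j) (dualGen ρ Θ α (jE ϖ ^ j) h' x₀) → ¬ IsOrd ρ α (jE ϖ ^ j) (dualGen ρ Θ α (jE ϖ ^ j) h' x₀ / jE ϖ) → Valued.v (dualGen ρ Θ α (jE ϖ ^ j) h' x₀) = Valued.v (jE ϖ) ^ b →
          (∀ b', (∀ x ∈ Λ, Valued.v (h' * Θ x * b' + ρ (h' * Θ x * b')) ≤ 1) → (lam - jE ((u : Matrix (Fin 1) (Fin 1) E) 0 0)) * b' ∈ Λ) → IsOrd ρ α (jE ϖ ^ j) lam →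
          jE r = glueUnit ρ Θ α (jE ϖ ^ j) h' (jE ϖ) (jE η) x₀ b →
          f' b j Λ = Nat.card {x : 𝒪[E] ⧸ 𝓂[E] ^ (2 * b) // ∃ u' : 𝒪[E], Ideal.Quotient.mk (𝓂[E] ^ (2 * b)) u' = x ∧ Valued.v ((u' : E) * σ u' - r) ≤ Valued.v (ϖ ^ (2 * b))}),
            ∑ b ∈ Finset.Icc 1 R, ∑ j ∈ Finset.range (J + 1), (if IsOrd ρ α (jE ϖ ^ j) lam then
                ((∑ᶠ Λ ∈ levelSetDep ρ Θ α (jE ϖ) h j b (lam - jE ((u : Matrix (Fin 1) (Fin 1) E) 0 0)) ∩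
                      {Λ | ∃ B : Submodule 𝒪[E] (Fin 2 → E), B.toAddSubgroup.map φ = Λ ∧
                        ∃ L₃ : Submodule 𝒪[E] (Fin 3 → E), IsSelfDualLattice σ ϖ (!![((StdForm.antidiagonal 2).over E) 0 0, 0, ((StdForm.antidiagonal 2).over E) 0 1; 0, (1 : E), 0; ((StdForm.antidiagonal 2).over E) 1 0, 0, ((StdForm.antidiagonal 2).over E) 1 1] : Matrix (Fin 3) (Fin 3) E) L₃ ∧
                          L₃ ⊓ LinearMap.ker ((LinearMap.proj (1 : Fin 3) : (Fin 3 → E) →ₗ[E] E).restrictScalars 𝒪[E]) =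
                            B.map ((Matrix.toLin' (!![1, 0; 0, 0; 0, 1] : Matrix (Fin 3) (Fin 2) E)).restrictScalars 𝒪[E]) ∧
                          (∀ c : E, (Pi.single 1 c : Fin 3 → E) ∈ L₃ ↔ Valued.v c ≤ Valued.v ϖ ^ b) ∧
                          (LatticeNearTransvShell ϖ (d % 2) (mstarOfRecord d) ((((endoGL (γ₂, u) : GL (Fin 3) E) : Matrix (Fin 3) (Fin 3) E) - 1)) L₃ ∧
                            {z : E | ∃ y ∈ L₃, Valued.v ((ϖ ^ (mstarOfRecord d))⁻¹ * (z - pairing σ (!![((StdForm.antidiagonal 2).over E) 0 0, 0, ((StdForm.antidiagonal 2).over E) 0 1; 0, (1 : E), 0; ((StdForm.antidiagonal 2).over E) 1 0, 0, ((StdForm.antidiagonal 2).over E) 1 1] : Matrix (Fin 3) (Fin 3) E) y (((((endoGL (γ₂, u) : GL (Fin 3) E) : Matrix (Fin 3) (Fin 3) E) - 1)) *ᵥ y))) ≤ 1} =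
                              valueSetMod σ ϖ (mstarOfRecord d) (xPlus σ ϖ d))}, f b j Λ : ℕ) : ℤ) -
                  ((∑ᶠ Λ ∈ levelSetDep ρ Θ α (jE ϖ) h j b (lam - jE ((u : Matrix (Fin 1) (Fin 1) E) 0 0)) ∩
                      {Λ | ∃ B : Submodule 𝒪[E] (Fin 2 → E), B.toAddSubgroup.map φ = Λ ∧
                        ∃ L₃ : Submodule 𝒪[E] (Fin 3 → E), IsSelfDualLattice σ ϖ (!![((StdForm.antidiagonal 2).over E) 0 0, 0, ((StdForm.antidiagonal 2).over E) 0 1; 0, (1 : E), 0; ((StdForm.antidiagonal 2).over E) 1 0, 0, ((StdForm.antidiagonal 2).over E) 1 1] : Matrix (Fin 3) (Fin 3) E) L₃ ∧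
                          L₃ ⊓ LinearMap.ker ((LinearMap.proj (1 : Fin 3) : (Fin 3 → E) →ₗ[E] E).restrictScalars 𝒪[E]) =
                            B.map ((Matrix.toLin' (!![1, 0; 0, 0; 0, 1] : Matrix (Fin 3) (Fin 2) E)).restrictScalars 𝒪[E]) ∧
                          (∀ c : E, (Pi.single 1 c : Fin 3 → E) ∈ L₃ ↔ Valued.v c ≤ Valued.v ϖ ^ b) ∧
                          (LatticeNearTransvShell ϖ (d % 2) (mcOfRecord d) ((((endoGL (γ₂, u) : GL (Fin 3) E) : Matrix (Fin 3) (Fin 3) E) - 1)) L₃ ∧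
                            ¬ {z : E | ∃ y ∈ L₃, Valued.v ((ϖ ^ (mstarOfRecord d))⁻¹ * (z - pairing σ (!![((StdForm.antidiagonal 2).over E) 0 0, 0, ((StdForm.antidiagonal 2).over E) 0 1; 0, (1 : E), 0; ((StdForm.antidiagonal 2).over E) 1 0, 0, ((StdForm.antidiagonal 2).over E) 1 1] : Matrix (Fin 3) (Fin 3) E) y (((((endoGL (γ₂, u) : GL (Fin 3) E) : Matrix (Fin 3) (Fin 3) E) - 1)) *ᵥ y))) ≤ 1} =
                              valueSetMod σ ϖ (mstarOfRecord d) (xPlus σ ϖ d))}, f b j Λ : ℕ) : ℤ) else 0) =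
            ∑ b ∈ Finset.Icc 1 R', ∑ j ∈ Finset.range (J + 1), (if IsOrd ρ α (jE ϖ ^ j) lam then
                ((∑ᶠ Λ ∈ levelSetDep ρ Θ α (jE ϖ) h' j b (lam - jE ((u : Matrix (Fin 1) (Fin 1) E) 0 0)) ∩
                      {Λ | ∃ B : Submodule 𝒪[E] (Fin 2 → E), B.toAddSubgroup.map φ' = Λ ∧
                        ∃ L₃ : Submodule 𝒪[E] (Fin 3 → E), IsSelfDualLattice σ ϖ (!![(Matrix.diagonal dg) 0 0, 0, (Matrix.diagonal dg) 0 1; 0, η, 0; (Matrix.diagonal dg) 1 0, 0, (Matrix.diagonal dg) 1 1] : Matrix (Fin 3) (Fin 3) E) L₃ ∧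
                          L₃ ⊓ LinearMap.ker ((LinearMap.proj (1 : Fin 3) : (Fin 3 → E) →ₗ[E] E).restrictScalars 𝒪[E]) =
                            B.map ((Matrix.toLin' (!![1, 0; 0, 0; 0, 1] : Matrix (Fin 3) (Fin 2) E)).restrictScalars 𝒪[E]) ∧
                          (∀ c : E, (Pi.single 1 c : Fin 3 → E) ∈ L₃ ↔ Valued.v c ≤ Valued.v ϖ ^ b) ∧
                          (LatticeNearTransvShell ϖ (d % 2) (mstarOfRecord d) ((((endoGL (γ₁, u) : GL (Fin 3) E) : Matrix (Fin 3) (Fin 3) E) - 1)) L₃ ∧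
                            {z : E | ∃ y ∈ L₃, Valued.v ((ϖ ^ (mstarOfRecord d))⁻¹ * (z - pairing σ (!![(Matrix.diagonal dg) 0 0, 0, (Matrix.diagonal dg) 0 1; 0, η, 0; (Matrix.diagonal dg) 1 0, 0, (Matrix.diagonal dg) 1 1] : Matrix (Fin 3) (Fin 3) E) y (((((endoGL (γ₁, u) : GL (Fin 3) E) : Matrix (Fin 3) (Fin 3) E) - 1)) *ᵥ y))) ≤ 1} =
                              valueSetMod σ ϖ (mstarOfRecord d) (xPlus σ ϖ d))}, f' b j Λ : ℕ) : ℤ) -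
                  ((∑ᶠ Λ ∈ levelSetDep ρ Θ α (jE ϖ) h' j b (lam - jE ((u : Matrix (Fin 1) (Fin 1) E) 0 0)) ∩
                      {Λ | ∃ B : Submodule 𝒪[E] (Fin 2 → E), B.toAddSubgroup.map φ' = Λ ∧
                        ∃ L₃ : Submodule 𝒪[E] (Fin 3 → E), IsSelfDualLattice σ ϖ (!![(Matrix.diagonal dg) 0 0, 0, (Matrix.diagonal dg) 0 1; 0, η, 0; (Matrix.diagonal dg) 1 0, 0, (Matrix.diagonal dg) 1 1] : Matrix (Fin 3) (Fin 3) E) L₃ ∧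
                          L₃ ⊓ LinearMap.ker ((LinearMap.proj (1 : Fin 3) : (Fin 3 → E) →ₗ[E] E).restrictScalars 𝒪[E]) =
                            B.map ((Matrix.toLin' (!![1, 0; 0, 0; 0, 1] : Matrix (Fin 3) (Fin 2) E)).restrictScalars 𝒪[E]) ∧
                          (∀ c : E, (Pi.single 1 c : Fin 3 → E) ∈ L₃ ↔ Valued.v c ≤ Valued.v ϖ ^ b) ∧
                          (LatticeNearTransvShell ϖ (d % 2) (mcOfRecord d) ((((endoGL (γ₁, u) : GL (Fin 3) E) : Matrix (Fin 3) (Fin 3) E) - 1)) L₃ ∧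
                            ¬ {z : E | ∃ y ∈ L₃, Valued.v ((ϖ ^ (mstarOfRecord d))⁻¹ * (z - pairing σ (!![(Matrix.diagonal dg) 0 0, 0, (Matrix.diagonal dg) 0 1; 0, η, 0; (Matrix.diagonal dg) 1 0, 0, (Matrix.diagonal dg) 1 1] : Matrix (Fin 3) (Fin 3) E) y (((((endoGL (γ₁, u) : GL (Fin 3) E) : Matrix (Fin 3) (Fin 3) E) - 1)) *ᵥ y))) ≤ 1} =
                              valueSetMod σ ϖ (mstarOfRecord d) (xPlus σ ϖ d))}, f' b j Λ : ℕ) : ℤ) else 0) := by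
  intro E M _ _ _ _ _ _ _ _ _ _ σ ϖ d tE hD hσσ h2 jE ρ Θ α lam hρρ hvρ hρj hjv hjfix hΘj hΘΘ hΘρ hvΘ hα hα1 hint hΘlam hvlam hbasis hU hτ hσres hjiso hq hddE hfixE h2M
    hjpow hEval hϖmax γ₂ u hdet htr hirr hlam2 hρlam m jl hm hjl hs hp hNm hu1N hlam1 hu hum hg1 P₁ dg η γ₁ hΓ hΓ' hA hdg1 hdgσ hησ hη1 hηN hγ₁ hA12
    φ h φ' h' hφs hφi hφo hφγ hform hΘh hh hhyper hφ's hφ'i hφ'o hφ'γ hform' hΘh' hh' J R R' f f' hfinF hR hfinF' hR' hJ hfinLS hfinLS' hf hf'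
  -- literal 1: the hyperbolic block `((Φ₂).over E, 1)` in the identity frame
  have hH₂ : IsUnit ((StdForm.antidiagonal 2).over E).det := by rw [det_antidiagonal_two]; exact isUnit_one.neg
  have hH₂σ : ((((StdForm.antidiagonal 2).over E).map σ))ᵀ = (StdForm.antidiagonal 2).over E := by rw [StdForm.over_map, StdForm.transpose_over]
  have hΓ₁ : (1 : GL (Fin 3) E) * endoGL (γ₂, u) * 1⁻¹ ∈ unitaryGroupOfForm σ ((StdForm.antidiagonal 3).over E) := by rwa [one_mul, inv_one, mul_one]
  have hoff₁ := hoff E M σ ϖ d tE hD hσσ h2 jE ρ Θ α lam hρρ hvρ hρj hjv hjfix hΘj hΘΘ hΘρ hvΘ hα hα1 hint hΘlam hvlam hbasis hU hτ hσres hjiso hq hddE hfixE h2M hjpow hEval hϖmax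
    γ₂ u hdet htr hirr hlam2 hρlam m jl hm hjl hs hp hNm hu1N hlam1 hu hum ((StdForm.antidiagonal 2).over E) 1 hH₂ hH₂σ (by rw [map_one]) (map_one σ) 1
    (formCongr_one_antidiagonal_three_eq_endoShape_two σ) hΓ₁ φ h hφs hφi hφo hφγ hform hΘh hh J R f hfinF hR hJ hfinLS hf
  -- literal 2: the anisotropic block `(diag dg, η)` in the frame `P₁`; `tr ∕ det γ₁ = tr ∕ det γ₂`
  have htr₁ : (γ₁ : Matrix (Fin 2) (Fin 2) E).trace = (γ₂ : Matrix (Fin 2) (Fin 2) E).trace := by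
    rw [Matrix.trace_eq_neg_charpoly_coeff, Matrix.trace_eq_neg_charpoly_coeff, hA12]
  have hdet₁ : (γ₁ : Matrix (Fin 2) (Fin 2) E).det = (γ₂ : Matrix (Fin 2) (Fin 2) E).det := by
    rw [Matrix.det_eq_sign_charpoly_coeff, Matrix.det_eq_sign_charpoly_coeff, hA12]
  have hH₂' : IsUnit (Matrix.diagonal dg).det := by
    rw [Matrix.det_diagonal]; refine isUnit_iff_ne_zero.2 (Finset.prod_ne_zero_iff.2 fun i _ h0 => ?_)
    have h1 := hdg1 i; rw [h0, map_zero] at h1; exact zero_ne_one h1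
  have hH₂σ' : ((Matrix.diagonal dg).map σ)ᵀ = Matrix.diagonal dg := by
    rw [Matrix.diagonal_map (map_zero _), Matrix.diagonal_transpose]; exact congrArg Matrix.diagonal (funext hdgσ)
  have hoff₂ := hoff E M σ ϖ d tE hD hσσ h2 jE ρ Θ α lam hρρ hvρ hρj hjv hjfix hΘj hΘΘ hΘρ hvΘ hα hα1 hint hΘlam hvlam hbasis hU hτ hσres hjiso hq hddE hfixE h2M hjpow hEval hϖmax
    γ₁ u (by rw [hdet₁]; exact hdet) (by rw [htr₁, hdet₁]; exact htr) (by rw [htr₁, hdet₁]; exact hirr) (by rw [htr₁, hdet₁]; exact hlam2) (by rw [htr₁]; exact hρlam)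
    m jl hm hjl (by rw [htr₁]; exact hs) (by rw [htr₁, hdet₁]; exact hp) hNm hu1N hlam1 hu hum (Matrix.diagonal dg) η hH₂' hH₂σ' hη1 hησ P₁ hA hΓ'
    φ' h' hφ's hφ'i hφ'o hφ'γ hform' hΘh' hh' J R' f' hfinF' hR' hJ hfinLS' hf'
  have hrow₁ := hrow E M σ ϖ d tE hD hσσ h2 jE ρ Θ α lam hρρ hvρ hρj hjv hjfix hΘj hΘΘ hΘρ hvΘ hα hα1 hint hΘlam hvlam hbasis hU hτ hσres hjiso hq hddE hfixE h2M
    hjpow hEval hϖmax γ₂ u hdet htr hirr hlam2 hρlam m jl hm hjl hs hp hNm hu1N hlam1 hu hum hg1 P₁ dg η γ₁ hΓ hΓ' hA hdg1 hdgσ hησ hη1 hηN hγ₁ hA12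
    φ h φ' h' hφs hφi hφo hφγ hform hΘh hh hhyper hφ's hφ'i hφ'o hφ'γ hform' hΘh' hh' J R R' f f' hfinF hR hfinF' hR' hJ hfinLS hfinLS' hf hf'
  -- split each cone sum at the live row `2b + d % 2 = m`
  rw [← Finset.sum_filter_add_sum_filter_not (Finset.Icc 1 R) (fun b => 2 * b + d % 2 = m),
    ← Finset.sum_filter_add_sum_filter_not (Finset.Icc 1 R') (fun b => 2 * b + d % 2 = m), hrow₁]
  refine (add_right_inj _).2 ((Finset.sum_eq_zero fun b hb => ?_).trans (Finset.sum_eq_zero fun b hb => ?_).symm)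
  · obtain ⟨hbI, hbm⟩ := Finset.mem_filter.1 hb
    exact Finset.sum_eq_zero fun j hj => by
      split_ifs with hord
      · exact hoff₁ b hbI hbm j hj hord
      · rfl
  · obtain ⟨hbI, hbm⟩ := Finset.mem_filter.1 hb
    exact Finset.sum_eq_zero fun j hj => by
      split_ifs with hord
      · exact hoff₂ b hbI hbm j hj hord
      · rfl

end Summit.HodgeConjecture.HodgeConjecture.Cruxes.H413.F0P3cDyRamBeta2ConesAOfRowsParity

end
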